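import Literature.Probability.Percolation.TriPathCrossings
import Literature.Probability.Percolation.SiteSharpnessStep
import HarnessLib

/-!
# A ladder of rectangle crossings carries the arm of the origin to infinity (site percolation on `𝕋`)

Topic `Literature/Probability/Percolation`; family `crit-perc`. The deterministic (planar-
combinatorial) half of the standard "once the arm has reached scale `m`, overlapping rectangle
crossings take it to infinity" argument (Nolin 2008, §7.4, proof of Cor. 41 [arXiv 0711.4948:
Cor. 39]: "It suffices to consider overlapping parallelograms (…), each parallelogram twice larger
than the previous one"; Kesten 1987; Werner 2009, Lecture 6, §1; Grimmett 1999, §11.7–11.8 for the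
four-rectangle circuits), for SITE percolation on the triangular lattice `𝕋 = triGraph`, where all
paths live on the same lattice. Third layer of the bottom-up discharge of **crit-perc.S16**
(`Literature.Probability.Percolation.triTheta_exponent`): it is the combinatorial input of the leaf `Nolin2008_cor41`
(`θ(p) ≥ c P_p(0 ↔ ∂Λ_{L(p)})`, `NearCriticalScaling.lean`), whose probabilistic half (RSW at
`p = 1/2`, uniform exponential decay above `L(p)`, Harris–FKG) is kept for a sibling file.

**The configuration.** Fix a set of sites `ω` (the open sites), a scale `m ≥ 1` and levels
`a : ℕ → ℤ`, strictly increasing with `a 0 = m`, `a 1 = 2m` (in the application `a k = 2^k m`).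
Suppose `ω` contains `𝕋`-paths realising
* an **arm** from the origin to a site outside the open square `(-2m, 2m)²`;
* a **hook**: left–right crossings of the top and bottom rectangles `[-2m, 2m] × [m, 2m]`,
  `[-2m, 2m] × [-2m, -m]` and a top–bottom crossing of the left rectangle `[-2m, -m] × [-2m, 2m]`
  of the square annulus `[-2m, 2m]² ∖ (-m, m)²`;
* for every `k`, a top–bottom crossing of the **rung** `V_k = [a k, a (k+1)] × [-a (k+1), a (k+1)]`
  (for `k = 0` this is the right rectangle `[m, 2m] × [-2m, 2m]` of the annulus) and a left–right
  crossing of the **rail** `H_k = [a k, a (k+2)] × [-a k, a k]`.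
Then the crossing of `V_0` lies in the open cluster of the origin (`TriLadder.hook`), so does
every rung crossing, the origin being joined inside `ω` to a site on the line `{x₀ = a (k+2)}` for
every `k` (`TriLadder.climb`), hence its open cluster is infinite (`TriLadder.percolates`,
`TriLadder.percolates_of_arm`). No new definitions: rungs, rails and the hook rectangles are
written out as sets of sites with explicit integer bounds, as in `TriPathCrossings.lean`.

**Proof.** Let `C = {z | 0 ↔ z in ω}`. A `𝕋`-path of sites of `ω` lies entirely inside `C` or
entirely outside it (`PathIn.inter_or_diff_cluster`). If the four annulus crossings all avoided
`C`, the arm (a path inside `C`, `PathIn.restrict`) would meet one of them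
(`PathIn.meets_annulus_crossings`, `TriPathCrossings.lean`) — impossible; and whichever crossing
lies in `C` drags the rung `V_0` into `C`, because transverse crossings of a parallelogram meet
(`PathIn.tri_crossings_meet`). Inductively, the rung `V_k ⊆ C` meets the initial segment of the
rail `H_k` (a left–right crossing of `V_k`, `PathIn.exists_slab_crossing`), so `H_k ⊆ C` — giving
the far site `x₀ = a (k+2)` — and the final segment of `H_k` is a left–right crossing of `V_{k+1}`,
so `V_{k+1} ⊆ C`.

## References

* P. Nolin, Near-critical percolation in two dimensions, *Electron. J. Probab.* 13 (2008), §7.4,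
  Cor. 41 and its proof (arXiv 0711.4948: Cor. 39) [Nolin2008].
* G. Grimmett, *Percolation*, 2nd ed. (1999), §11.7, proof of (11.78); §11.8 [GrimmettPercolation1999].
* W. Werner, Lectures on two-dimensional critical percolation (2009), Lecture 6, §1 [WernerPCMI2009].

Tree: `PathIn` and its API (`SitePaths.lean`), `PathIn.restrict` (`SiteSharpnessStep.lean`),
`PathIn.tri_crossings_meet` (`TriCrossingsMeet.lean`), `PathIn.exists_slab_crossing`,
`PathIn.meets_annulus_crossings` (`TriPathCrossings.lean`), `siteCluster`, `sitePercolatesAt`,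
`siteOpenGraph_adj` (`Percolation.lean`). Mathlib: `Set.Finite.bddAbove`, `SimpleGraph.Reachable`.
-/

namespace Literature.Probability.Percolation

open SimpleGraph

noncomputable section

/-! ### Paths of open sites lie inside or outside the cluster of the origin -/

/-- The set of sites joined to `x` inside `ω` is closed under `ω`-adjacency, so a `𝕋`-path (indeed
a `G`-path) of sites of `ω` lies entirely inside it or entirely outside it. [folklore] -/
theorem PathIn.inter_or_diff_cluster {V : Type*} {G : SimpleGraph V} {ω S : Set V} {x u v : V}
    (hS : S ⊆ ω) (h : PathIn G S u v) :
    PathIn G (S ∩ {z | PathIn G ω x z}) u v ∨ PathIn G (S \ {z | PathIn G ω x z}) u v := by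
  obtain ⟨hu, h⟩ := h
  by_cases hux : PathIn G ω x u
  · left
    induction h with
    | refl => exact PathIn.refl ⟨hu, hux⟩
    | @tail b c _ hbc ih => exact ih.tail hbc.1 ⟨hbc.2, ih.right_mem.2.tail hbc.1 (hS hbc.2)⟩
  · right
    induction h with
    | refl => exact PathIn.refl ⟨hu, hux⟩
    | @tail b c _ hbc ih =>
      refine ih.tail hbc.1 ⟨hbc.2, fun hc => ih.right_mem.2 ?_⟩
      exact hc.tail hbc.1.symm (hS ih.right_mem.1)

/-- A `G`-path of open sites from `x` to `z` puts `z` in the open cluster of `x`. [folklore] -/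
theorem mem_siteCluster_of_pathIn {V : Type*} {G : SimpleGraph V} {ω : Set V} {x z : V}
    (h : PathIn G ω x z) : z ∈ siteCluster G ω x := by
  obtain ⟨hx, h⟩ := h
  refine ⟨hx, PathIn.right_mem ⟨hx, h⟩, ?_⟩
  induction h with
  | refl => exact Reachable.refl _
  | @tail b c hxb hbc ih =>
    exact ih.trans (Adj.reachable ((siteOpenGraph_adj G ω b c).2
      ⟨hbc.1, PathIn.right_mem ⟨hx, hxb⟩, hbc.2⟩))

/-! ### Transverse crossings drag each other into the cluster -/

/-- In a parallelogram `[L, R] × [B, T]`: if a left–right path has its sites in the cluster `C` of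
`x` and a top–bottom path has its sites in `S ⊆ ω` (inside the parallelogram), then the top–bottom
path lies in `C` too (they meet, `PathIn.tri_crossings_meet`). [folklore] -/
theorem PathIn.tb_inter_cluster_of_lr {ω S A : Set (LatticeModels.Site 2)} {x a b c d : LatticeModels.Site 2} {L R B T : ℤ}
    (hA : ∀ z ∈ A, L ≤ z 0 ∧ z 0 ≤ R ∧ B ≤ z 1 ∧ z 1 ≤ T)
    (hSb : ∀ z ∈ S, L ≤ z 0 ∧ z 0 ≤ R ∧ B ≤ z 1 ∧ z 1 ≤ T) (hS : S ⊆ ω)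
    (hP : PathIn LatticeModels.triGraph (A ∩ {z | PathIn LatticeModels.triGraph ω x z}) a b) (ha : a 0 = L) (hb : b 0 = R)
    (hQ : PathIn LatticeModels.triGraph S c d) (hc : c 1 = B) (hd : d 1 = T) :
    PathIn LatticeModels.triGraph (S ∩ {z | PathIn LatticeModels.triGraph ω x z}) c d := by
  rcases hQ.inter_or_diff_cluster (x := x) hS with h | h
  · exact h
  · obtain ⟨z, hz, hz'⟩ := PathIn.tri_crossings_meet (fun z hz => hA z hz.1)
      (fun z hz => hSb z hz.1) hP ha hb h hc hd
    exact absurd hz.2 hz'.2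

/-- The same with the roles exchanged: a top–bottom path inside the cluster drags a left–right
path of `S ⊆ ω` into the cluster. [folklore] -/
theorem PathIn.lr_inter_cluster_of_tb {ω S A : Set (LatticeModels.Site 2)} {x a b c d : LatticeModels.Site 2} {L R B T : ℤ}
    (hA : ∀ z ∈ A, L ≤ z 0 ∧ z 0 ≤ R ∧ B ≤ z 1 ∧ z 1 ≤ T)
    (hSb : ∀ z ∈ S, L ≤ z 0 ∧ z 0 ≤ R ∧ B ≤ z 1 ∧ z 1 ≤ T) (hS : S ⊆ ω)
    (hP : PathIn LatticeModels.triGraph (A ∩ {z | PathIn LatticeModels.triGraph ω x z}) a b) (ha : a 1 = B) (hb : b 1 = T)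
    (hQ : PathIn LatticeModels.triGraph S c d) (hc : c 0 = L) (hd : d 0 = R) :
    PathIn LatticeModels.triGraph (S ∩ {z | PathIn LatticeModels.triGraph ω x z}) c d := by
  rcases hQ.inter_or_diff_cluster (x := x) hS with h | h
  · exact h
  · obtain ⟨z, hz, hz'⟩ := PathIn.tri_crossings_meet' (fun z hz => hA z hz.1)
      (fun z hz => hSb z hz.1) hP ha hb h hc hd
    exact absurd hz.2 hz'.2

/-! ### The ladder -/

namespace TriLadder

/-- **The hook.** Let `m ≥ 1`. If `ω` contains an arm from the origin to a site outside the open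
square `(-2m, 2m)²` and, in the annulus `[-2m, 2m]² ∖ (-m, m)²`, left–right crossings of the top and
bottom rectangles `[-2m, 2m] × [m, 2m]`, `[-2m, 2m] × [-2m, -m]` and top–bottom crossings of the
left and right rectangles `[-2m, -m] × [-2m, 2m]`, `[m, 2m] × [-2m, 2m]`, then the crossing of the
right rectangle lies in the open cluster `{z | 0 ↔ z in ω}` of the origin. (If all four crossings
avoided the cluster, the arm would meet one of them, `PathIn.meets_annulus_crossings`; whichever
lies in the cluster drags the right one in, `PathIn.tri_crossings_meet`.) The four-rectangle
circuit is that of Grimmett 1999, §11.7, proof of (11.78); its use to hook the arm of the origin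
to larger scales is Nolin 2008, §7.4, proof of Cor. 41. [cite: Nolin2008, §7.4, Cor. 41 (proof; arXiv 0711.4948: Cor. 39)] -/
theorem hook {ω : Set (LatticeModels.Site 2)} {m : ℤ} (hm : 1 ≤ m)
    (harm : ∃ t : LatticeModels.Site 2, (t 0 ≤ -(2 * m) ∨ 2 * m ≤ t 0 ∨ t 1 ≤ -(2 * m) ∨ 2 * m ≤ t 1) ∧
      PathIn LatticeModels.triGraph ω 0 t)
    (htop : ∃ u v : LatticeModels.Site 2, u 0 = -(2 * m) ∧ v 0 = 2 * m ∧
      PathIn LatticeModels.triGraph (ω ∩ {z | -(2 * m) ≤ z 0 ∧ z 0 ≤ 2 * m ∧ m ≤ z 1 ∧ z 1 ≤ 2 * m}) u v)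
    (hbot : ∃ u v : LatticeModels.Site 2, u 0 = -(2 * m) ∧ v 0 = 2 * m ∧
      PathIn LatticeModels.triGraph (ω ∩ {z | -(2 * m) ≤ z 0 ∧ z 0 ≤ 2 * m ∧ -(2 * m) ≤ z 1 ∧ z 1 ≤ -m}) u v)
    (hleft : ∃ u v : LatticeModels.Site 2, u 1 = -(2 * m) ∧ v 1 = 2 * m ∧
      PathIn LatticeModels.triGraph (ω ∩ {z | -(2 * m) ≤ z 0 ∧ z 0 ≤ -m ∧ -(2 * m) ≤ z 1 ∧ z 1 ≤ 2 * m}) u v)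
    (hright : ∃ u v : LatticeModels.Site 2, u 1 = -(2 * m) ∧ v 1 = 2 * m ∧
      PathIn LatticeModels.triGraph (ω ∩ {z | m ≤ z 0 ∧ z 0 ≤ 2 * m ∧ -(2 * m) ≤ z 1 ∧ z 1 ≤ 2 * m}) u v) :
    ∃ u v : LatticeModels.Site 2, u 1 = -(2 * m) ∧ v 1 = 2 * m ∧
      PathIn LatticeModels.triGraph (ω ∩ {z | m ≤ z 0 ∧ z 0 ≤ 2 * m ∧ -(2 * m) ≤ z 1 ∧ z 1 ≤ 2 * m} ∩
        {z | PathIn LatticeModels.triGraph ω 0 z}) u v := by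
  set C : Set (LatticeModels.Site 2) := {z | PathIn LatticeModels.triGraph ω 0 z} with hC
  obtain ⟨ur, vr, hur, hvr, hr⟩ := hright
  obtain ⟨ut, vt, hut, hvt, ht⟩ := htop
  obtain ⟨ub, vb, hub, hvb, hb⟩ := hbot
  obtain ⟨ul, vl, hul, hvl, hl⟩ := hleft
  obtain ⟨t, htout, harm⟩ := harm
  -- the four crossing regions lie inside the outer square `[-2m, 2m]²`
  have bR : ∀ z ∈ ω ∩ {z : LatticeModels.Site 2 | m ≤ z 0 ∧ z 0 ≤ 2 * m ∧ -(2 * m) ≤ z 1 ∧ z 1 ≤ 2 * m},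
      -(2 * m) ≤ z 0 ∧ z 0 ≤ 2 * m ∧ -(2 * m) ≤ z 1 ∧ z 1 ≤ 2 * m := by
    intro z hz; have := hz.2; simp only [Set.mem_setOf_eq] at this; omega
  have bT : ∀ z ∈ ω ∩ {z : LatticeModels.Site 2 | -(2 * m) ≤ z 0 ∧ z 0 ≤ 2 * m ∧ m ≤ z 1 ∧ z 1 ≤ 2 * m},
      -(2 * m) ≤ z 0 ∧ z 0 ≤ 2 * m ∧ -(2 * m) ≤ z 1 ∧ z 1 ≤ 2 * m := by
    intro z hz; have := hz.2; simp only [Set.mem_setOf_eq] at this; omega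
  have bB : ∀ z ∈ ω ∩ {z : LatticeModels.Site 2 | -(2 * m) ≤ z 0 ∧ z 0 ≤ 2 * m ∧ -(2 * m) ≤ z 1 ∧ z 1 ≤ -m},
      -(2 * m) ≤ z 0 ∧ z 0 ≤ 2 * m ∧ -(2 * m) ≤ z 1 ∧ z 1 ≤ 2 * m := by
    intro z hz; have := hz.2; simp only [Set.mem_setOf_eq] at this; omega
  have bL : ∀ z ∈ ω ∩ {z : LatticeModels.Site 2 | -(2 * m) ≤ z 0 ∧ z 0 ≤ -m ∧ -(2 * m) ≤ z 1 ∧ z 1 ≤ 2 * m},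
      -(2 * m) ≤ z 0 ∧ z 0 ≤ 2 * m ∧ -(2 * m) ≤ z 1 ∧ z 1 ≤ 2 * m := by
    intro z hz; have := hz.2; simp only [Set.mem_setOf_eq] at this; omega
  -- a top or bottom crossing inside the cluster drags the right crossing into it
  have fromTop : PathIn LatticeModels.triGraph (ω ∩ {z : LatticeModels.Site 2 | -(2 * m) ≤ z 0 ∧ z 0 ≤ 2 * m ∧ m ≤ z 1 ∧
      z 1 ≤ 2 * m} ∩ C) ut vt → PathIn LatticeModels.triGraph (ω ∩ {z : LatticeModels.Site 2 | m ≤ z 0 ∧ z 0 ≤ 2 * m ∧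
      -(2 * m) ≤ z 1 ∧ z 1 ≤ 2 * m} ∩ C) ur vr := fun htC =>
    PathIn.tb_inter_cluster_of_lr bT bR Set.inter_subset_left htC hut hvt hr hur hvr
  have fromBot : PathIn LatticeModels.triGraph (ω ∩ {z : LatticeModels.Site 2 | -(2 * m) ≤ z 0 ∧ z 0 ≤ 2 * m ∧
      -(2 * m) ≤ z 1 ∧ z 1 ≤ -m} ∩ C) ub vb → PathIn LatticeModels.triGraph (ω ∩ {z : LatticeModels.Site 2 | m ≤ z 0 ∧
      z 0 ≤ 2 * m ∧ -(2 * m) ≤ z 1 ∧ z 1 ≤ 2 * m} ∩ C) ur vr := fun hbC =>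
    PathIn.tb_inter_cluster_of_lr bB bR Set.inter_subset_left hbC hub hvb hr hur hvr
  refine ⟨ur, vr, hur, hvr, ?_⟩
  -- which of the four crossings lies in the cluster?
  rcases hr.inter_or_diff_cluster (x := 0) Set.inter_subset_left with hrC | hrD
  · exact hrC
  rcases ht.inter_or_diff_cluster (x := 0) Set.inter_subset_left with htC | htD
  · exact fromTop htC
  rcases hb.inter_or_diff_cluster (x := 0) Set.inter_subset_left with hbC | hbD
  · exact fromBot hbC
  rcases hl.inter_or_diff_cluster (x := 0) Set.inter_subset_left with hlC | hlD
  · -- the left crossing drags the top crossing, which drags the right one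
    exact fromTop (PathIn.lr_inter_cluster_of_tb bL bT Set.inter_subset_left hlC hul hvl ht hut hvt)
  -- all four avoid the cluster: the arm, a path inside the cluster, would meet one of them
  exfalso
  set K : Set (LatticeModels.Site 2) := (ω \ C) ∩ {z | -(2 * m) ≤ z 0 ∧ z 0 ≤ 2 * m ∧ -(2 * m) ≤ z 1 ∧
    z 1 ≤ 2 * m} with hK
  have sub : ∀ {S : Set (LatticeModels.Site 2)} {P : LatticeModels.Site 2 → Prop},
      (∀ z ∈ ω ∩ S, -(2 * m) ≤ z 0 ∧ z 0 ≤ 2 * m ∧ -(2 * m) ≤ z 1 ∧ z 1 ≤ 2 * m) →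
      (∀ z ∈ ω ∩ S, P z) → (ω ∩ S) \ C ⊆ K ∩ {z | P z} := by
    intro S P hb hP z hz
    exact ⟨⟨⟨hz.1.1, hz.2⟩, hb z hz.1⟩, hP z hz.1⟩
  obtain ⟨z, hzC, hzK⟩ := PathIn.meets_annulus_crossings (A := C) (K := K)
    (L₂ := -(2 * m)) (L₁ := -m) (R₁ := m) (R₂ := 2 * m) (B₂ := -(2 * m)) (B₁ := -m) (T₁ := m)
    (T₂ := 2 * m) (by omega) (by omega) (by omega) (by omega) (fun z hz => hz.2)
    ⟨ut, vt, hut, hvt, htD.mono (sub bT fun z hz => hz.2.2.2.1)⟩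
    ⟨ub, vb, hub, hvb, hbD.mono (sub bB fun z hz => hz.2.2.2.2)⟩
    ⟨ul, vl, hul, hvl, hlD.mono (sub bL fun z hz => hz.2.2.1)⟩
    ⟨ur, vr, hur, hvr, hrD.mono (sub bR fun z hz => hz.2.1)⟩
    (s := 0) (t := t) (by simp only [Pi.zero_apply]; omega) htout
    (harm.restrict.mono fun z hz => hz.2)
  exact hzK.1.2 hzC

/-- **Climbing the ladder.** Let `a : ℕ → ℤ` be strictly increasing with `a 0 > 0`, and suppose
`ω` contains, for every `k`, a top–bottom crossing of the rung
`V_k = [a k, a (k+1)] × [-a (k+1), a (k+1)]` and a left–right crossing of the rail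
`H_k = [a k, a (k+2)] × [-a k, a k]`, and that the crossing of `V_0` lies in the open cluster of
the origin. Then every rung crossing lies in that cluster, and for every `k` the origin is joined
inside `ω` to a site of the line `{x₀ = a (k+2)}`: the rung `V_k` meets the initial segment of the
rail `H_k` (a left–right crossing of `V_k`, `PathIn.exists_slab_crossing`) and the final segment
of `H_k` is a left–right crossing of `V_{k+1}` (Nolin 2008, §7.4, proof of Cor. 41: "overlapping
parallelograms (…), each parallelogram twice larger than the previous one"). [cite: Nolin2008, §7.4, Cor. 41 (proof; arXiv 0711.4948: Cor. 39)] -/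
theorem climb {ω : Set (LatticeModels.Site 2)} {a : ℕ → ℤ} (ha : StrictMono a) (ha0 : 0 < a 0)
    (hrung : ∀ k, ∃ u v : LatticeModels.Site 2, u 1 = -a (k + 1) ∧ v 1 = a (k + 1) ∧
      PathIn LatticeModels.triGraph (ω ∩ {z | a k ≤ z 0 ∧ z 0 ≤ a (k + 1) ∧ -a (k + 1) ≤ z 1 ∧
        z 1 ≤ a (k + 1)}) u v)
    (hrail : ∀ k, ∃ u v : LatticeModels.Site 2, u 0 = a k ∧ v 0 = a (k + 2) ∧
      PathIn LatticeModels.triGraph (ω ∩ {z | a k ≤ z 0 ∧ z 0 ≤ a (k + 2) ∧ -a k ≤ z 1 ∧ z 1 ≤ a k}) u v)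
    (h0 : ∃ u v : LatticeModels.Site 2, u 1 = -a 1 ∧ v 1 = a 1 ∧
      PathIn LatticeModels.triGraph (ω ∩ {z | a 0 ≤ z 0 ∧ z 0 ≤ a 1 ∧ -a 1 ≤ z 1 ∧ z 1 ≤ a 1} ∩
        {z | PathIn LatticeModels.triGraph ω 0 z}) u v) (k : ℕ) :
    (∃ u v : LatticeModels.Site 2, u 1 = -a (k + 1) ∧ v 1 = a (k + 1) ∧
        PathIn LatticeModels.triGraph (ω ∩ {z | a k ≤ z 0 ∧ z 0 ≤ a (k + 1) ∧ -a (k + 1) ≤ z 1 ∧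
          z 1 ≤ a (k + 1)} ∩ {z | PathIn LatticeModels.triGraph ω 0 z}) u v) ∧
      ∃ z : LatticeModels.Site 2, z 0 = a (k + 2) ∧ PathIn LatticeModels.triGraph ω 0 z := by
  set C : Set (LatticeModels.Site 2) := {z | PathIn LatticeModels.triGraph ω 0 z} with hC
  -- one step: rung `V_k ⊆ C` ⟹ rail `H_k ⊆ C` ⟹ (far site, rung `V_{k+1} ⊆ C`)
  have step : ∀ k, (∃ u v : LatticeModels.Site 2, u 1 = -a (k + 1) ∧ v 1 = a (k + 1) ∧
      PathIn LatticeModels.triGraph (ω ∩ {z | a k ≤ z 0 ∧ z 0 ≤ a (k + 1) ∧ -a (k + 1) ≤ z 1 ∧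
        z 1 ≤ a (k + 1)} ∩ C) u v) →
      (∃ z : LatticeModels.Site 2, z 0 = a (k + 2) ∧ PathIn LatticeModels.triGraph ω 0 z) ∧
        ∃ u v : LatticeModels.Site 2, u 1 = -a (k + 2) ∧ v 1 = a (k + 2) ∧
          PathIn LatticeModels.triGraph (ω ∩ {z | a (k + 1) ≤ z 0 ∧ z 0 ≤ a (k + 2) ∧ -a (k + 2) ≤ z 1 ∧
            z 1 ≤ a (k + 2)} ∩ C) u v := by
    intro k ⟨ur, vr, hur, hvr, hr⟩
    have hk1 : a k < a (k + 1) := ha (Nat.lt_succ_self k)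
    have hk2 : a (k + 1) < a (k + 2) := ha (Nat.lt_succ_self (k + 1))
    have hk0 : 0 < a k := lt_of_lt_of_le ha0 (ha.monotone (Nat.zero_le k))
    obtain ⟨uh, vh, huh, hvh, hh⟩ := hrail k
    -- the rail `H_k` lies in `C`
    have hhC : PathIn LatticeModels.triGraph (ω ∩ {z : LatticeModels.Site 2 | a k ≤ z 0 ∧ z 0 ≤ a (k + 2) ∧ -a k ≤ z 1 ∧
        z 1 ≤ a k} ∩ C) uh vh := by
      rcases hh.inter_or_diff_cluster (x := 0) Set.inter_subset_left with hhC | hhD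
      · exact hhC
      exfalso
      obtain ⟨a', b', ha', hb', hq⟩ :=
        hhD.exists_slab_crossing 0 (le_of_lt hk1) (le_of_eq huh) (by rw [hvh]; exact le_of_lt hk2)
      obtain ⟨z, hz, hz'⟩ := PathIn.tri_crossings_meet' (L := a k) (R := a (k + 1))
        (B := -a (k + 1)) (T := a (k + 1)) (A' := _ ∩ {z : LatticeModels.Site 2 | a k ≤ z 0 ∧ z 0 ≤ a (k + 1)})
        (fun z hz => by have := hz.1.2; simp only [Set.mem_setOf_eq] at this; omega)
        (fun z hz => by
          have h1 := hz.1.1.2; have h2 := hz.2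
          simp only [Set.mem_setOf_eq] at h1 h2; omega)
        hr hur hvr hq ha' hb'
      exact hz'.1.2 hz.2
    refine ⟨⟨vh, hvh, hhC.right_mem.2⟩, ?_⟩
    -- the rung `V_{k+1}` lies in `C`
    obtain ⟨u', v', hu', hv', hr'⟩ := hrung (k + 1)
    refine ⟨u', v', hu', hv', ?_⟩
    rcases hr'.inter_or_diff_cluster (x := 0) Set.inter_subset_left with hrC | hrD
    · exact hrC
    exfalso
    obtain ⟨a', b', ha', hb', hq⟩ :=
      hhC.exists_slab_crossing 0 (le_of_lt hk2) (by rw [huh]; exact le_of_lt hk1) (le_of_eq hvh.symm)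
    obtain ⟨z, hz, hz'⟩ := PathIn.tri_crossings_meet' (L := a (k + 1)) (R := a (k + 2))
      (B := -a (k + 2)) (T := a (k + 2)) (A' := _ ∩ {z : LatticeModels.Site 2 | a (k + 1) ≤ z 0 ∧ z 0 ≤ a (k + 2)})
      (fun z hz => by have := hz.1.2; simp only [Set.mem_setOf_eq] at this; omega)
      (fun z hz => by
        have h1 := hz.1.1.2; have h2 := hz.2
        simp only [Set.mem_setOf_eq] at h1 h2; omega)
      hrD hu' hv' hq ha' hb'
    exact hz.2 hz'.1.2
  -- induction along the ladder
  induction k with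
  | zero => exact ⟨h0, (step 0 h0).1⟩
  | succ k ih =>
    have h1 := (step k ih.1).2
    exact ⟨h1, (step (k + 1) h1).1⟩

/-- **The ladder reaches infinity.** Under the hypotheses of `climb`, the open cluster of the
origin is infinite: it contains a site on each of the lines `{x₀ = a (k+2)}`, `k ∈ ℕ`, and
`a (k+2) ≥ k + 2`. (Nolin 2008, §7.4, proof of Cor. 41.) [cite: Nolin2008, §7.4, Cor. 41 (proof; arXiv 0711.4948: Cor. 39)] -/
theorem percolates {ω : Set (LatticeModels.Site 2)} {a : ℕ → ℤ} (ha : StrictMono a) (ha0 : 0 < a 0)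
    (hrung : ∀ k, ∃ u v : LatticeModels.Site 2, u 1 = -a (k + 1) ∧ v 1 = a (k + 1) ∧
      PathIn LatticeModels.triGraph (ω ∩ {z | a k ≤ z 0 ∧ z 0 ≤ a (k + 1) ∧ -a (k + 1) ≤ z 1 ∧
        z 1 ≤ a (k + 1)}) u v)
    (hrail : ∀ k, ∃ u v : LatticeModels.Site 2, u 0 = a k ∧ v 0 = a (k + 2) ∧
      PathIn LatticeModels.triGraph (ω ∩ {z | a k ≤ z 0 ∧ z 0 ≤ a (k + 2) ∧ -a k ≤ z 1 ∧ z 1 ≤ a k}) u v)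
    (h0 : ∃ u v : LatticeModels.Site 2, u 1 = -a 1 ∧ v 1 = a 1 ∧
      PathIn LatticeModels.triGraph (ω ∩ {z | a 0 ≤ z 0 ∧ z 0 ≤ a 1 ∧ -a 1 ≤ z 1 ∧ z 1 ≤ a 1} ∩
        {z | PathIn LatticeModels.triGraph ω 0 z}) u v) :
    ω ∈ sitePercolatesAt LatticeModels.triGraph 0 := by
  -- `a (k+2) > k`
  have hgrow : ∀ k : ℕ, (k : ℤ) < a (k + 2) := by
    intro k
    induction k with
    | zero =>
      have := ha.monotone (Nat.zero_le 2)
      push_cast; omega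
    | succ k ih =>
      have := ha (Nat.lt_add_one (k + 2))
      show ((k + 1 : ℕ) : ℤ) < a (k + 2 + 1)
      push_cast; omega
  intro hfin
  obtain ⟨N, hN⟩ := (hfin.image fun z : LatticeModels.Site 2 => z 0).bddAbove
  obtain ⟨z, hz0, hz⟩ := (climb ha ha0 hrung hrail h0 N.toNat).2
  have hzN : z 0 ≤ N := hN (Set.mem_image_of_mem _ (mem_siteCluster_of_pathIn hz))
  have := hgrow N.toNat
  have hNN : N ≤ (N.toNat : ℤ) := Int.self_le_toNat N
  omega

/-- **The hooked ladder percolates.** Let `m ≥ 1` and `a : ℕ → ℤ` strictly increasing with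
`a 0 = m`, `a 1 = 2m`. If `ω` contains an arm from the origin out of the open square
`(-2m, 2m)²`, the three hook crossings (top, bottom, left rectangles of the annulus
`[-2m, 2m]² ∖ (-m, m)²`), and for every `k` crossings of the rung `V_k` (whose `k = 0` instance is
the right rectangle of the annulus) and of the rail `H_k`, then the open cluster of the origin is
infinite (Nolin 2008, §7.4, proof of Cor. 41; `hook` + `percolates`). [cite: Nolin2008, §7.4, Cor. 41 (proof; arXiv 0711.4948: Cor. 39)] -/
theorem percolates_of_arm {ω : Set (LatticeModels.Site 2)} {m : ℤ} {a : ℕ → ℤ} (hm : 1 ≤ m)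
    (ha : StrictMono a) (ha0 : a 0 = m) (ha1 : a 1 = 2 * m)
    (harm : ∃ t : LatticeModels.Site 2, (t 0 ≤ -(2 * m) ∨ 2 * m ≤ t 0 ∨ t 1 ≤ -(2 * m) ∨ 2 * m ≤ t 1) ∧
      PathIn LatticeModels.triGraph ω 0 t)
    (htop : ∃ u v : LatticeModels.Site 2, u 0 = -(2 * m) ∧ v 0 = 2 * m ∧
      PathIn LatticeModels.triGraph (ω ∩ {z | -(2 * m) ≤ z 0 ∧ z 0 ≤ 2 * m ∧ m ≤ z 1 ∧ z 1 ≤ 2 * m}) u v)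
    (hbot : ∃ u v : LatticeModels.Site 2, u 0 = -(2 * m) ∧ v 0 = 2 * m ∧
      PathIn LatticeModels.triGraph (ω ∩ {z | -(2 * m) ≤ z 0 ∧ z 0 ≤ 2 * m ∧ -(2 * m) ≤ z 1 ∧ z 1 ≤ -m}) u v)
    (hleft : ∃ u v : LatticeModels.Site 2, u 1 = -(2 * m) ∧ v 1 = 2 * m ∧
      PathIn LatticeModels.triGraph (ω ∩ {z | -(2 * m) ≤ z 0 ∧ z 0 ≤ -m ∧ -(2 * m) ≤ z 1 ∧ z 1 ≤ 2 * m}) u v)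
    (hrung : ∀ k, ∃ u v : LatticeModels.Site 2, u 1 = -a (k + 1) ∧ v 1 = a (k + 1) ∧
      PathIn LatticeModels.triGraph (ω ∩ {z | a k ≤ z 0 ∧ z 0 ≤ a (k + 1) ∧ -a (k + 1) ≤ z 1 ∧
        z 1 ≤ a (k + 1)}) u v)
    (hrail : ∀ k, ∃ u v : LatticeModels.Site 2, u 0 = a k ∧ v 0 = a (k + 2) ∧
      PathIn LatticeModels.triGraph (ω ∩ {z | a k ≤ z 0 ∧ z 0 ≤ a (k + 2) ∧ -a k ≤ z 1 ∧ z 1 ≤ a k}) u v) :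
    ω ∈ sitePercolatesAt LatticeModels.triGraph 0 := by
  refine percolates ha (by rw [ha0]; omega) hrung hrail ?_
  have h := hrung 0
  simp only [ha0, ha1, zero_add] at h ⊢
  have := hook hm harm htop hbot hleft h
  simpa only [ha0, ha1] using this

end TriLadder

end

end Literature.Probability.Percolation
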